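import Literature.Analysis.FluidPDE.LerayHopfForcedOpenStrip
import Literature.Analysis.FluidPDE.TaoFiniteEnergyLerayHopf
import HarnessLib

/-!
# Forced classical solutions on an open time strip are continuous into `L²` in the interior;
  the Leray–Hopf property from the `L²` attainment of the datum alone (`ℝ³`)

Analysis/FluidPDE proofs-layer file (theorems only), sequel of `LerayHopfForcedOpenStrip.lean`.
There the Leray–Hopf property of a forced classical solution on an open strip `(0, T)` was proved
under the hypothesis `v ∈ C([0, T); L²)`; here that hypothesis is reduced, on `ℝ³`, to the strong
attainment of the datum at `t = 0⁺` alone, the continuity into `L²` at positive times being a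
CONSEQUENCE of the forced energy equality and of weak continuity (Leray 1934, §17; Galdi 2000,
Thm. 4.1; the device of the tree's `TaoFiniteEnergyLerayHopf.lean`). This is the form needed for
the self-similar solutions of Albritton–Brué–Colombo 2022 (in-tree fact
`albritton_brue_colombo`), for which `‖u(t)‖₂ = t^{1/4}‖U(log t)‖₂ → 0` is read off the profile
while nothing else is known a priori about `t ↦ u(t) ∈ L²`.

## Main results (all proved)

* `tendsto_kineticEnergy_of_energyEq_forced` (general `E`) — continuity of `t ↦ ½‖u(t)‖₂²` on
  `[a, b]` under the forced energy equality `E(t) + ν∫ₛᵗD = E(s) + ∫ₛᵗΦ`, `∫D < ∞`,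
  `Φ` interval integrable (absolute continuity of the dissipation integral, continuity of the
  primitive of `Φ`).
* `ContinuousInLpOn.of_translate_Icc` (general) — time translation of `C([0, b − a]; L^p)` to
  `C([a, b]; L^p)`.
* `IsClassicalNSSolutionOn.continuousInLpOn_Icc_forced` (`ℝ³`) — a forced classical solution on
  `(0, T)` with `‖u(t)‖₂ ≤ L`, `∇u ∈ L²`, `⟪f,u⟫ ∈ L¹`, and `u ∈ L³`, `p u ∈ L¹` on interior slabs is
  in `C([a, b]; L²)` for `0 < a < b < T` (energy continuity + weak continuity of the translate
  `u(· + a)` via `tendsto_integral_inner_of_continuousOn` + Radon–Riesz,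
  `continuousInLpOn_of_energy_of_weak`).
* `isLerayHopfOn_of_classical_Ioo_forced_R3` (`ℝ³`) — **the Leray–Hopf property from the datum
  alone**: as `isLerayHopfOn_of_classical_Ioo_forced`, with `v ∈ C([0,T); L²)` replaced by
  `‖u(t) − u₀‖₂ → 0` (`t → 0⁺`).

## Design notes

The last two results are stated on `ℝ³` only because the two inputs from
`TaoFiniteEnergyLerayHopf.lean` are; their proofs are dimension-free. Interior intervals
`[t₀/2, (t₀+T)/2]` serve as neighbourhoods of `t₀ ∈ (0, T)` within `[0, T)`; at `t₀ = 0` the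
filter `𝓝[[0,T)] 0 ≤ 𝓝[≥] 0 = pure 0 ⊔ 𝓝[>] 0` is handled by the datum hypothesis.

## Tree / Mathlib search

Tree: `tendsto_kineticEnergy_of_energyEq`, `tendsto_integral_inner_of_continuousOn`,
`continuousInLpOn_of_energy_of_weak` (`TaoFiniteEnergyLerayHopf`, unforced / closed slab);
`energyEq_Ioo_forced`, `translate_Icc_of_Ioo_forced`, `integrableOn_forcePairing_of_continuousOn`,
`isLerayHopfOn_of_classical_Ioo_forced` (`LerayHopfForcedOpenStrip`). Mathlib:
`tendsto_setLIntegral_zero`, `intervalIntegral.continuousOn_primitive_interval'`,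
`ContinuousWithinAt.tendsto_nhdsWithin`, `nhdsWithin_insert`, `Ioi_insert`.

## References

* J. Leray, Acta Math. 63 (1934), §17 (3.4) p. 220, §32 p. 242. [Leray1934]
* G. P. Galdi, *An introduction to the Navier–Stokes initial-boundary value problem* (2000),
  §2 and Thm. 4.1. [Galdi2000]
* W. S. Ożański, B. C. Pooley, LMS Lecture Note Ser. 452 (2018) = arXiv:1708.09787, Lemma 6.21,
  Def. 6.20. [OzanskiPooley2018]
* D. Albritton, E. Brué, M. Colombo, Ann. of Math. 196 (2022) = arXiv:2112.03116, Thm. 1.3 and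
  (1.13). [AlbrittonBrueColombo2022]
-/

noncomputable section

open MeasureTheory TopologicalSpace Set Function Filter Topology InnerProductSpace
open scoped RealInnerProductSpace ENNReal NNReal

namespace Literature.Analysis.FluidPDE

/-! ### Continuity of the kinetic energy under the forced energy equality -/

section Energy

variable {E : Type*} [NormedAddCommGroup E] [InnerProductSpace ℝ E] [FiniteDimensional ℝ E]
  [MeasurableSpace E] [BorelSpace E]

/-- **Continuity of the energy under the forced energy equality.** If on `[a, b]`
`E(u(t)) + ν∫ₛᵗ D = E(u(s)) + ∫ₛᵗ Φ` for `a ≤ s ≤ t ≤ b`, with `∫ₐᵇ D < ∞` (`D ≥ 0` the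
dissipation rate, no measurability needed) and `Φ` (the work of the force) interval integrable,
then `t ↦ E(u(t))` is continuous on `[a, b]`:
`|E(t) − E(t₀)| ≤ |ν| ∫_{[t₀,t]} D + |∫_{t₀}^{t} Φ| → 0` by absolute continuity of the finite
dissipation integral and continuity of the primitive of `Φ` (the forced twin of
`tendsto_kineticEnergy_of_energyEq`). [folklore] -/
theorem tendsto_kineticEnergy_of_energyEq_forced {a b ν : ℝ} {u : ℝ → E → E} {D : ℝ → ℝ≥0∞}
    {Φ : ℝ → ℝ} (hD : ∫⁻ τ in Ioo a b, D τ < ⊤) (hΦ : IntervalIntegrable Φ volume a b)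
    (hE : ∀ {s t : ℝ}, a ≤ s → s ≤ t → t ≤ b → VectorCalculus.kineticEnergy (u t) +
      ν * (∫⁻ τ in Ioo s t, D τ).toReal = VectorCalculus.kineticEnergy (u s) + ∫ τ in s..t, Φ τ)
    {t₀ : ℝ} (ht₀ : t₀ ∈ Icc a b) :
    Tendsto (fun t => VectorCalculus.kineticEnergy (u t)) (𝓝[Icc a b] t₀)
      (𝓝 (VectorCalculus.kineticEnergy (u t₀))) := by
  have hab : a ≤ b := ht₀.1.trans ht₀.2
  set μ : Measure ℝ := volume.restrict (Ioo a b) with hμ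
  -- the symmetric interval around `t₀`
  set I : ℝ → Set ℝ := fun t => Ioo (min t₀ t) (max t₀ t) with hI
  have hvol : Tendsto (μ ∘ I) (𝓝[Icc a b] t₀) (𝓝 0) := by
    have h1 : ∀ t, (μ ∘ I) t ≤ ENNReal.ofReal |t - t₀| := by
      intro t
      simp only [Function.comp, hμ, hI]
      calc volume.restrict (Ioo a b) (Ioo (min t₀ t) (max t₀ t))
          ≤ volume (Ioo (min t₀ t) (max t₀ t)) := Measure.restrict_apply_le _ _
        _ = ENNReal.ofReal |t - t₀| := by
            rw [Real.volume_Ioo, max_sub_min_eq_abs', abs_sub_comm]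
    have h2 : Tendsto (fun t => ENNReal.ofReal |t - t₀|) (𝓝[Icc a b] t₀) (𝓝 0) := by
      have : Tendsto (fun t : ℝ => |t - t₀|) (𝓝 t₀) (𝓝 0) := by
        have hc : Continuous fun t : ℝ => |t - t₀| := (continuous_id.sub continuous_const).abs
        simpa using hc.tendsto t₀
      have h3 := (ENNReal.continuous_ofReal.tendsto 0).comp this
      rw [ENNReal.ofReal_zero] at h3
      exact h3.mono_left nhdsWithin_le_nhds
    exact tendsto_of_tendsto_of_tendsto_of_le_of_le tendsto_const_nhds h2 (fun _ => bot_le) h1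
  have hac := tendsto_setLIntegral_zero (μ := μ) (f := D) hD.ne hvol
  -- the primitive of `Φ` from `t₀` is continuous and vanishes at `t₀`
  have hprim : Tendsto (fun t => ∫ τ in t₀..t, Φ τ) (𝓝[Icc a b] t₀) (𝓝 0) := by
    have h1 := intervalIntegral.continuousOn_primitive_interval' hΦ
      (by rw [uIcc_of_le hab]; exact ht₀)
    have h2 := (h1 t₀ (by rw [uIcc_of_le hab]; exact ht₀)).tendsto
    rw [uIcc_of_le hab] at h2
    simpa only [intervalIntegral.integral_same] using h2
  -- `|E(t) - E(t₀)| ≤ |ν| (∫_{I t} D).toReal + |∫_{t₀}^{t} Φ|`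
  have hdiff : ∀ t ∈ Icc a b,
      |VectorCalculus.kineticEnergy (u t) - VectorCalculus.kineticEnergy (u t₀)| ≤
        |ν| * (∫⁻ τ in I t, D τ ∂μ).toReal + |∫ τ in t₀..t, Φ τ| := by
    intro t ht
    have hrestr : ∀ {a' b' : ℝ}, a ≤ a' → b' ≤ b →
        ∫⁻ τ in Ioo a' b', D τ ∂μ = ∫⁻ τ in Ioo a' b', D τ := by
      intro a' b' ha hb
      rw [hμ, Measure.restrict_restrict measurableSet_Ioo,
        inter_eq_left.2 (Ioo_subset_Ioo ha hb)]
    have hX : ∀ X : ℝ≥0∞, |ν * X.toReal| ≤ |ν| * X.toReal := fun X => by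
      rw [abs_mul, abs_of_nonneg ENNReal.toReal_nonneg]
    rcases le_total t₀ t with h0 | h0
    · have e := hE ht₀.1 h0 ht.2
      rw [hI]
      simp only [min_eq_left h0, max_eq_right h0]
      rw [hrestr ht₀.1 ht.2]
      have : VectorCalculus.kineticEnergy (u t) - VectorCalculus.kineticEnergy (u t₀) =
          -(ν * (∫⁻ τ in Ioo t₀ t, D τ).toReal) + ∫ τ in t₀..t, Φ τ := by linarith
      rw [this]
      calc |-(ν * (∫⁻ τ in Ioo t₀ t, D τ).toReal) + ∫ τ in t₀..t, Φ τ|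
          ≤ |-(ν * (∫⁻ τ in Ioo t₀ t, D τ).toReal)| + |∫ τ in t₀..t, Φ τ| := abs_add_le _ _
        _ ≤ |ν| * (∫⁻ τ in Ioo t₀ t, D τ).toReal + |∫ τ in t₀..t, Φ τ| := by
            rw [abs_neg]
            gcongr
            exact hX _
    · have e := hE ht.1 h0 ht₀.2
      rw [hI]
      simp only [min_eq_right h0, max_eq_left h0]
      rw [hrestr ht.1 ht₀.2, intervalIntegral.integral_symm t t₀] at *
      have : VectorCalculus.kineticEnergy (u t) - VectorCalculus.kineticEnergy (u t₀) =
          ν * (∫⁻ τ in Ioo t t₀, D τ).toReal + -∫ τ in t..t₀, Φ τ := by linarith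
      rw [this]
      calc |ν * (∫⁻ τ in Ioo t t₀, D τ).toReal + -∫ τ in t..t₀, Φ τ|
          ≤ |ν * (∫⁻ τ in Ioo t t₀, D τ).toReal| + |-∫ τ in t..t₀, Φ τ| := abs_add_le _ _
        _ ≤ |ν| * (∫⁻ τ in Ioo t t₀, D τ).toReal + |-∫ τ in t..t₀, Φ τ| := by
            gcongr
            exact hX _
  -- the bound tends to zero
  have hbound : Tendsto (fun t => |ν| * (∫⁻ τ in I t, D τ ∂μ).toReal + |∫ τ in t₀..t, Φ τ|)
      (𝓝[Icc a b] t₀) (𝓝 0) := by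
    have h1 : Tendsto (fun t => (∫⁻ τ in I t, D τ ∂μ).toReal) (𝓝[Icc a b] t₀) (𝓝 0) := by
      rw [← ENNReal.toReal_zero]
      exact (ENNReal.tendsto_toReal ENNReal.zero_ne_top).comp hac
    have h2 : Tendsto (fun t => |∫ τ in t₀..t, Φ τ|) (𝓝[Icc a b] t₀) (𝓝 0) := by
      simpa using hprim.abs
    simpa using (h1.const_mul |ν|).add h2
  rw [tendsto_iff_norm_sub_tendsto_zero]
  refine squeeze_zero' (Eventually.of_forall fun t => norm_nonneg _) ?_ hbound
  filter_upwards [self_mem_nhdsWithin] with t ht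
  rw [Real.norm_eq_abs]
  exact hdiff t ht

end Energy

/-! ### Translation of `C(S; L^p)` in time -/

section Translate

variable {X : Type*} [MeasureSpace X] {F : Type*} [NormedAddCommGroup F]

/-- **Time translation of continuity into `L^p`**: if `t ↦ u(t + a)` is in `C([0, b − a]; L^p)`
then `u ∈ C([a, b]; L^p)` (composition with the homeomorphism `t ↦ t − a` of `[a, b]` onto
`[0, b − a]`). [folklore] -/
theorem ContinuousInLpOn.of_translate_Icc {q : ℝ≥0∞} {u : ℝ → X → F} {a b : ℝ}
    (h : ContinuousInLpOn (Icc 0 (b - a)) q (fun t => u (t + a))) :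
    ContinuousInLpOn (Icc a b) q u := by
  have hmap : ∀ {t : ℝ}, t ∈ Icc a b → t - a ∈ Icc 0 (b - a) := fun ht =>
    ⟨by linarith [ht.1], by linarith [ht.2]⟩
  refine ⟨fun t ht => by simpa only [sub_add_cancel] using h.1 (t - a) (hmap ht), fun t₀ ht₀ => ?_⟩
  have hT : Tendsto (fun t : ℝ => t - a) (𝓝[Icc a b] t₀) (𝓝[Icc 0 (b - a)] (t₀ - a)) :=
    ((continuous_id.sub continuous_const).continuousWithinAt).tendsto_nhdsWithin
      (fun t ht => hmap ht)
  have := (h.2 (t₀ - a) (hmap ht₀)).comp hT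
  simpa only [Function.comp_def, sub_add_cancel] using this

end Translate

/-! ### Interior `L²` continuity of forced classical solutions on `ℝ³ × (0, T)` -/

section Interior

variable {T ν : ℝ} {f u : ℝ → (EuclideanSpace ℝ (Fin 3)) → (EuclideanSpace ℝ (Fin 3))} {p : ℝ → (EuclideanSpace ℝ (Fin 3)) → ℝ}

/-- **A forced classical solution of finite energy on an open strip is continuous into `L²` on
every interior closed interval** `[a, b] ⊂ (0, T)` (Leray 1934, §17; Galdi 2000, Thm. 4.1). Let
`(u, p)` be a classical solution of the forced Navier–Stokes system on `ℝ³ × (0, T)` with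
`‖u(t)‖_{L²} ≤ L < ∞`, `∇u ∈ L²((0,T) × ℝ³)`, `⟪f, u⟫ ∈ L¹((0,T) × ℝ³)`, and `u ∈ L³`,
`p u ∈ L¹` on interior slabs. Then `u ∈ C([a, b]; L²)` for `0 < a < b < T`: the energy
`t ↦ ½‖u(t)‖₂²` is continuous by the forced energy equality
(`energyEq_Ioo_forced`, `tendsto_kineticEnergy_of_energyEq_forced`), `t ↦ ∫⟪u(t), w⟫` is
continuous for `w ∈ L²` (`tendsto_integral_inner_of_continuousOn`, applied to the translate
`u(· + a)` on `[0, b − a]`), and strong continuity follows by Radon–Riesz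
(`continuousInLpOn_of_energy_of_weak`). [cite: Leray1934, §17 (3.4) p. 220] -/
theorem IsClassicalNSSolutionOn.continuousInLpOn_Icc_forced
    (hcl : IsClassicalNSSolutionOn (Ioo 0 T) ν f u p) {L : ℝ≥0∞} (hLt : L ≠ ⊤)
    (hL : ∀ t ∈ Ioo 0 T, eLpNorm (u t) 2 volume ≤ L)
    (hgrad : ∫⁻ τ in Ioo 0 T, ∫⁻ x, ENNReal.ofReal (frobeniusNormSq (fderiv ℝ (u τ) x)) < ∞)
    (hu₃ : ∀ s t : ℝ, 0 < s → s < t → t < T →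
      ∫⁻ τ in Ioo s t, ∫⁻ x, ‖u τ x‖ₑ ^ (3 : ℕ) < ∞)
    (hpu : ∀ s t : ℝ, 0 < s → s < t → t < T →
      ∫⁻ τ in Ioo s t, ∫⁻ x, ‖p τ x‖ₑ * ‖u τ x‖ₑ < ∞)
    (hfu : ∫⁻ τ in Ioo 0 T, ∫⁻ x, ‖f τ x‖ₑ * ‖u τ x‖ₑ < ∞)
    {a b : ℝ} (ha : 0 < a) (hab : a < b) (hbT : b < T) :
    ContinuousInLpOn (Icc a b) 2 u := by
  set D : ℝ → ℝ≥0∞ := fun τ => ∫⁻ x, ENNReal.ofReal (frobeniusNormSq (fderiv ℝ (u τ) x))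
    with hD_def
  have hIcc : ∀ {t : ℝ}, t ∈ Icc a b → t ∈ Ioo 0 T := fun ht =>
    ⟨ha.trans_le ht.1, ht.2.trans_lt hbT⟩
  have hmem : ∀ t ∈ Ioo 0 T, MemLp (u t) 2 volume := fun t ht =>
    ⟨(hcl.contDiff_velocity ht).continuous.aestronglyMeasurable, (hL t ht).trans_lt hLt.lt_top⟩
  -- interior slabs
  have hgrad' : ∀ s t : ℝ, 0 < s → s < t → t < T → ∫⁻ τ in Ioo s t, D τ < ∞ :=
    fun s t hs _ htT => (lintegral_mono_set (Ioo_subset_Ioo hs.le htT.le)).trans_lt hgrad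
  have hfu' : ∀ s t : ℝ, 0 < s → s < t → t < T →
      ∫⁻ τ in Ioo s t, ∫⁻ x, ‖f τ x‖ₑ * ‖u τ x‖ₑ < ∞ :=
    fun s t hs _ htT => (lintegral_mono_set (Ioo_subset_Ioo hs.le htT.le)).trans_lt hfu
  -- the forced energy equality on `[a, b]` (also for `s = t`)
  have hE : ∀ {s t : ℝ}, a ≤ s → s ≤ t → t ≤ b → VectorCalculus.kineticEnergy (u t) +
      ν * (∫⁻ τ in Ioo s t, D τ).toReal =
      VectorCalculus.kineticEnergy (u s) + ∫ τ in s..t, ∫ x, ⟪f τ x, u τ x⟫ := by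
    intro s t hs hst htb
    rcases hst.eq_or_lt with h | h
    · subst h
      simp
    · exact hcl.energyEq_Ioo_forced hLt hL hgrad' hu₃ hpu hfu' (ha.trans_le hs) h
        (htb.trans_lt hbT)
  -- continuity of the energy on `[a, b]`
  have hΦ : IntervalIntegrable (fun τ => ∫ x, ⟪f τ x, u τ x⟫) volume a b := by
    have h1 : IntegrableOn (fun τ => ∫ x, ⟪f τ x, u τ x⟫) (Ioo 0 T) volume :=
      integrableOn_forcePairing_of_continuousOn (hcl.continuousOn_force isOpen_Ioo.uniqueDiffOn)
        hcl.smooth_velocity.continuousOn hfu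
    rw [intervalIntegrable_iff_integrableOn_Ioo_of_le hab.le]
    exact h1.mono_set (Ioo_subset_Ioo ha.le hbT.le)
  have hKE : ∀ t₀ ∈ Icc a b, Tendsto (fun t => VectorCalculus.kineticEnergy (u t))
      (𝓝[Icc a b] t₀) (𝓝 (VectorCalculus.kineticEnergy (u t₀))) := fun t₀ ht₀ =>
    tendsto_kineticEnergy_of_energyEq_forced
      ((lintegral_mono_set (Ioo_subset_Ioo ha.le hbT.le)).trans_lt hgrad) hΦ hE ht₀
  -- the translate `ũ = u(· + a)` on `[0, b - a]`
  set ũ : ℝ → (EuclideanSpace ℝ (Fin 3)) → (EuclideanSpace ℝ (Fin 3)) := fun t => u (t + a) with hũ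
  have hba : 0 < b - a := sub_pos.2 hab
  have hIcc' : ∀ {t : ℝ}, t ∈ Icc 0 (b - a) → t + a ∈ Icc a b := fun ht =>
    ⟨by linarith [ht.1], by linarith [ht.2]⟩
  have hcl' : IsClassicalNSSolutionOn (Icc 0 (b - a)) ν (fun t => f (t + a)) ũ
      (fun t => p (t + a)) :=
    hcl.translate_Icc_of_Ioo_forced ha hba (by linarith)
  have hmem' : ∀ t ∈ Icc 0 (b - a), MemLp (ũ t) 2 volume := fun t ht =>
    hmem _ (hIcc (hIcc' ht))
  have hbound' : ∀ t ∈ Icc 0 (b - a), (eLpNorm (ũ t) 2 volume).toReal ≤ L.toReal :=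
    fun t ht => ENNReal.toReal_mono hLt (hL _ (hIcc (hIcc' ht)))
  have hcont' : ContinuousOn (fun z : ℝ × (EuclideanSpace ℝ (Fin 3)) => ũ z.1 z.2) (Icc 0 (b - a) ×ˢ univ) :=
    hcl'.smooth_velocity.continuousOn
  -- weak continuity of the translate
  have hweak' : ∀ {w : (EuclideanSpace ℝ (Fin 3)) → (EuclideanSpace ℝ (Fin 3))} (_ : MemLp w 2 volume) (t₀ : ℝ) (_ : t₀ ∈ Icc 0 (b - a)),
      Tendsto (fun t => ∫ x, ⟪ũ t x, w x⟫) (𝓝[Icc 0 (b - a)] t₀)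
        (𝓝 (∫ x, ⟪ũ t₀ x, w x⟫)) := fun hw t₀ ht₀ =>
    tendsto_integral_inner_of_continuousOn hcont' hmem' ENNReal.toReal_nonneg hbound' hw ht₀
  -- continuity of the energy of the translate
  have hKE' : ∀ t₀ ∈ Icc 0 (b - a), Tendsto (fun t => VectorCalculus.kineticEnergy (ũ t))
      (𝓝[Icc 0 (b - a)] t₀) (𝓝 (VectorCalculus.kineticEnergy (ũ t₀))) := by
    intro t₀ ht₀
    have hT : Tendsto (fun t : ℝ => t + a) (𝓝[Icc 0 (b - a)] t₀) (𝓝[Icc a b] (t₀ + a)) :=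
      ((continuous_id.add continuous_const).continuousWithinAt).tendsto_nhdsWithin
        (fun t ht => hIcc' ht)
    exact (hKE (t₀ + a) (hIcc' ht₀)).comp hT
  exact (continuousInLpOn_of_energy_of_weak hmem' hKE' hweak').of_translate_Icc

/-- **The Leray–Hopf property of a forced classical solution on `ℝ³ × (0, T)` from the `L²`
attainment of the datum alone** (Ożański–Pooley 2018, Lemma 6.21 with Def. 6.20; Leray 1934,
§32). Let `(u, p)` be a classical solution of the forced Navier–Stokes system on `ℝ³ × (0, T)`
with `‖u(t)‖_{L²} ≤ L < ∞`, `∇u ∈ L²((0,T) × ℝ³)`, `⟪f, u⟫ ∈ L¹((0,T) × ℝ³)`, `f ∈ L¹` on finite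
cylinders, `u ∈ L³` and `p u ∈ L¹` on interior slabs, attaining `u₀ ∈ L²` strongly in `L²` as
`t → 0⁺`; let `v = u` on `(0, T)` and `v(0) = u₀`. Then `v` is a Leray–Hopf weak solution on
`[0, T')` from `u₀` with force `f` for every `0 < T' < T`. This is
`isLerayHopfOn_of_classical_Ioo_forced` with its hypothesis `v ∈ C([0, T); L²)` discharged:
on `(0, T)` by `continuousInLpOn_Icc_forced` (interior intervals are neighbourhoods), at
`t = 0` by the attainment of the datum. [cite: OzanskiPooley2018, Lemma 6.21 with Def. 6.20] [cite: Leray1934, §32 p. 242] -/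
theorem isLerayHopfOn_of_classical_Ioo_forced_R3 {T' : ℝ} {L : ℝ≥0∞} (hT' : 0 < T')
    (hT'T : T' < T) {v : ℝ → (EuclideanSpace ℝ (Fin 3)) → (EuclideanSpace ℝ (Fin 3))} {u₀ : (EuclideanSpace ℝ (Fin 3)) → (EuclideanSpace ℝ (Fin 3))}
    (hcl : IsClassicalNSSolutionOn (Ioo 0 T) ν f u p) (hvw : ∀ t ∈ Ioo 0 T, v t = u t)
    (hv0 : v 0 = u₀) (hu₀ : MemLp u₀ 2 volume)
    (h0 : Tendsto (fun t => eLpNorm (u t - u₀) 2 volume) (𝓝[>] 0) (𝓝 0))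
    (hLt : L ≠ ⊤) (hL : ∀ t ∈ Ioo 0 T, eLpNorm (u t) 2 volume ≤ L)
    (hgrad : ∫⁻ τ in Ioo 0 T, ∫⁻ x, ENNReal.ofReal (frobeniusNormSq (fderiv ℝ (u τ) x)) < ∞)
    (hu₃ : ∀ s t : ℝ, 0 < s → s < t → t < T →
      ∫⁻ τ in Ioo s t, ∫⁻ x, ‖u τ x‖ₑ ^ (3 : ℕ) < ∞)
    (hpu : ∀ s t : ℝ, 0 < s → s < t → t < T →
      ∫⁻ τ in Ioo s t, ∫⁻ x, ‖p τ x‖ₑ * ‖u τ x‖ₑ < ∞)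
    (hfu : ∫⁻ τ in Ioo 0 T, ∫⁻ x, ‖f τ x‖ₑ * ‖u τ x‖ₑ < ∞)
    (hfK : ∀ K : Set (EuclideanSpace ℝ (Fin 3)), IsCompact K → IntegrableOn (uncurry f) (Ioo 0 T ×ˢ K) volume) :
    IsLerayHopfOn T' ν f u₀ v := by
  have hT : 0 < T := hT'.trans hT'T
  have hmem : ∀ t ∈ Ioo 0 T, MemLp (u t) 2 volume := fun t ht =>
    ⟨(hcl.contDiff_velocity ht).continuous.aestronglyMeasurable, (hL t ht).trans_lt hLt.lt_top⟩
  have hvc : ContinuousInLpOn (Ico 0 T) 2 v := by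
    refine ⟨fun t ht => ?_, fun t₀ ht₀ => ?_⟩
    · rcases ht.1.eq_or_lt with h | h
      · rw [← h, hv0]
        exact hu₀
      · rw [hvw t ⟨h, ht.2⟩]
        exact hmem t ⟨h, ht.2⟩
    · rcases ht₀.1.eq_or_lt with h | h
      · -- at `t₀ = 0`: the datum is attained
        subst h
        have h1 : Tendsto (fun t => eLpNorm (v t - v 0) 2 volume) (𝓝[>] 0) (𝓝 0) := by
          refine h0.congr' ?_
          filter_upwards [Ioo_mem_nhdsGT hT] with t ht
          rw [hvw t ht, hv0]
        have h2 : Tendsto (fun t => eLpNorm (v t - v 0) 2 volume) (pure 0) (𝓝 0) := by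
          have := tendsto_pure_nhds (fun t => eLpNorm (v t - v 0) 2 volume) 0
          simpa only [sub_self, eLpNorm_zero] using this
        have h3 : Tendsto (fun t => eLpNorm (v t - v 0) 2 volume) (𝓝[Ici 0] 0) (𝓝 0) := by
          rw [← Ioi_insert, nhdsWithin_insert]
          exact h2.sup h1
        exact h3.mono_left (nhdsWithin_mono _ Ico_subset_Ici_self)
      · -- at `t₀ ∈ (0, T)`: an interior interval `[a, b] ∋ t₀` is a neighbourhood within `[0, T)`
        set a : ℝ := t₀ / 2 with ha_def
        set b : ℝ := (t₀ + T) / 2 with hb_def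
        have ha : 0 < a := by rw [ha_def]; linarith
        have hat : a < t₀ := by rw [ha_def]; linarith
        have htb : t₀ < b := by rw [hb_def]; linarith [ht₀.2]
        have hbT : b < T := by rw [hb_def]; linarith [ht₀.2]
        have hc := hcl.continuousInLpOn_Icc_forced hLt hL hgrad hu₃ hpu hfu ha (hat.trans htb) hbT
        have h1 := hc.2 t₀ ⟨hat.le, htb.le⟩
        have hle : 𝓝[Ico 0 T] t₀ ≤ 𝓝[Icc a b] t₀ :=
          nhdsWithin_le_of_mem (mem_nhdsWithin_of_mem_nhds (Icc_mem_nhds hat htb))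
        refine (h1.mono_left hle).congr' ?_
        have hev : ∀ᶠ t in 𝓝[Ico 0 T] t₀, t ∈ Icc a b :=
          hle (self_mem_nhdsWithin)
        filter_upwards [hev] with t ht
        rw [hvw t ⟨ha.trans_le ht.1, ht.2.trans_lt hbT⟩, hvw t₀ ⟨h, ht₀.2⟩]
  exact isLerayHopfOn_of_classical_Ioo_forced hT' hT'T hcl hvw hv0 hu₀ hvc hLt hL hgrad hu₃ hpu
    hfu hfK

end Interior

end Literature.Analysis.FluidPDE

end
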